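import Summits.QuantumFields.QCD.Theses.PauliWegnerSea
import Summits.QuantumFields.QCD.Theorems.PauliWegnerSeaPhaseQuenchedFlavourDecayPionSecondMomentOfCrux
import Literature.MathematicalPhysics.QuantumFieldTheory.QCDPhaseQuenchedReweighting
import Literature.MathematicalPhysics.QuantumFieldTheory.QCDPhaseQuenchedPositivity
import Literature.MathematicalPhysics.QuantumFieldTheory.FermiFlavourPhase
import Literature.MathematicalPhysics.QuantumFieldTheory.QCDCurrentSector
import Literature.MathematicalPhysics.QuantumFieldTheory.QCDGoldstoneBound

/-!
# Stub `stub_pionWickNumerator` of line `Sketch`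
(crux `PauliWegnerSea.ChiralOneScaleTrajectory`, stmt-QuantumFields-17512)

**The un-normalised Wick contraction of the charged pion pair, in EVERY gauge background.**
For `N_f` Wilson flavours at the fully degenerate bare-mass tuple `m_h = t` (all `h`), two
flavours `f ≠ g`, and the pseudoscalar pair `A = (ψ̄_g γ₅ ψ_f)(x)`, `B = (ψ̄_f γ₅ ψ_g)(y)` on the
four-torus of side `L`, the Berezin integral against the fermionic Boltzmann factor is, for every
`SU(3)` field `U` and every REAL `t` (including those with `det D_W(U, t) = 0`),

`∫dψ̄dψ A B e^{−ψ̄ D_t ψ} = ε · (−det(D_W(t))^{N_f−2} Σ_{a,i,b,j} |adj D_W(t)((x,a,i),(y,b,j))|²)`,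

`ε = (−1)^{n(n−1)/2+n}` the orientation sign of the tree's Berezin integral
(`fermiIntegral_fermiBoltzmann`, `n` = number of quark variables),
`D_W(t) = wilsonDirac (fundamentalRep (Fin 3)) U t 1` the one-flavour Wilson–Dirac matrix and
`D_t = ⊕_h D_W(t)` (`diracMatrix U (fun _ => t)`).

Proof.  (A) For `t > 0` every `D_W(t)` is invertible (`wilsonDirac_det_ne_zero_of_pos`), so the
normalised contraction `pionPair_fermiRatio_eq` (`∫ A B e^{−ψ̄Dψ} / ∫ e^{−ψ̄Dψ} = −Σ |G_f(x→y)|²`,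
`G = D⁻¹`; Montvay–Münster (4.25)) can be multiplied through by the partition function
`∫ e^{−ψ̄Dψ} = ε det D = ε det(D_W(t))^{N_f}` ((4.17), `det_diracMatrix`); the flavour-`f` block
of `D⁻¹` is `D_W(t)⁻¹ = det(D_W(t))⁻¹ adj D_W(t)` and `det D_W(t)` is real (γ₅-hermiticity,
(5.15)–(5.16)), so `det^{N_f} |det|⁻² = det^{N_f−2}`.  (B) Both sides are polynomials in `t`
evaluated at `(t : ℂ)`: the left side because `D_t = D_0 + t·1`,
`e^{−ψ̄(D_0+t)ψ} = e^{−ψ̄D_0ψ} e^{−t ψ̄ψ}` and `e^{−t ψ̄ψ}` is a finite exponential sum in the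
nilpotent `ψ̄ψ`; the right side because `det`/`adj` of the polynomial matrix `D_W(0) + X·1`
evaluate to `det`/`adj` of `D_W(t)` and `|P(t)|² = P(t)·P̄(t)` for real `t`.  Two complex
polynomials agreeing on the infinite set `{(t : ℂ) | t > 0}` are equal
(`Polynomial.eq_of_infinite_eval_eq`).

Sources: I. Montvay, G. Münster, *Quantum Fields on a Lattice* (CUP 1994), §4.1 (4.17) (Gaussian
Berezin integral), §4.1.3 (4.25) (Wick rule), §5.1.2 (5.15)–(5.16) (γ₅-hermiticity, real quark
determinant).
-/

noncomputable section

namespace Summit.QuantumFields.QCD.Cruxes.ChiralOneScaleTrajectory.GoldstoneWitness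

open scoped BigOperators
open MeasureTheory Filter
open Literature.MathematicalPhysics.QuantumFieldTheory Literature.MathematicalPhysics.QuantumLattice
  Literature.Probability.LatticeModels

variable {Nf L : ℕ} [NeZero L]

omit [NeZero L] in
/-- **The bare mass enters the Wilson–Dirac matrix as a multiple of the identity**:
`D_W(U, m, r) = D_W(U, 0, r) + m·1` (Montvay–Münster (4.85)). -/
theorem wilsonDirac_mass_shift {G : Type*} [Group G] {N : ℕ}
    (ρ : G →* Matrix (Fin N) (Fin N) ℂ) (U : GaugeConfig 4 L G) (m r : ℝ) :
    wilsonDirac ρ U m r =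
      wilsonDirac ρ U 0 r +
        (m : ℂ) •
          (1 : Matrix (TorusSite 4 L × Fin N × Fin 4) (TorusSite 4 L × Fin N × Fin 4) ℂ) := by
  ext p q
  simp only [wilsonDirac, Matrix.of_apply, Matrix.add_apply, Matrix.smul_apply, Matrix.one_apply,
    smul_eq_mul, mul_ite, mul_one, mul_zero]
  split_ifs <;> push_cast <;> ring

/-- **The `N_f`-flavour Wilson matrix at a degenerate mass tuple**:
`D_{(t,…,t)} = D_{(0,…,0)} + t·1`. -/
theorem diracMatrix_const_eq_add (U : GaugeConfig 4 L SU3) (t : ℝ) :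
    diracMatrix U (fun _ : Fin Nf => t) =
      diracMatrix U (fun _ : Fin Nf => 0) +
        (t : ℂ) • (1 : Matrix (FermiIdx Nf L) (FermiIdx Nf L) ℂ) := by
  ext i j
  obtain ⟨⟨f₁, p⟩, rfl⟩ := quarkEquiv.surjective i
  obtain ⟨⟨f₂, q⟩, rfl⟩ := quarkEquiv.surjective j
  simp only [diracMatrix, Matrix.reindex_apply, Matrix.submatrix_apply, Matrix.of_apply,
    Equiv.symm_apply_apply, Matrix.add_apply, Matrix.smul_apply, Matrix.one_apply,
    EmbeddingLike.apply_eq_iff_eq, Prod.mk.injEq,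
    wilsonDirac_mass_shift (fundamentalRep (Fin 3)) U t 1, smul_eq_mul, mul_ite, mul_one, mul_zero]
  by_cases hf : f₁ = f₂
  · subst hf
    simp
  · simp [hf]

/-- **Factorisation of the Boltzmann factor at a degenerate mass tuple**:
`e^{−ψ̄ D_t ψ} = e^{−ψ̄ D_0 ψ} · e^{−t ψ̄ψ}` (the two quadratic actions commute). -/
theorem fermiBoltzmann_const_eq_mul (U : GaugeConfig 4 L SU3) (t : ℝ) :
    fermiBoltzmann U (fun _ : Fin Nf => t) =
      fermiBoltzmann U (fun _ : Fin Nf => 0) *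
        grassmannExp ((-(t : ℂ)) • quadratic ℂ (1 : Matrix (FermiIdx Nf L) (FermiIdx Nf L) ℂ)) := by
  simp only [fermiBoltzmann]
  rw [diracMatrix_const_eq_add, neg_add, grassmannExp_quadratic_add, ← neg_smul,
    quadratic_smul]

/-- **The un-normalised Berezin expectation of any observable is a polynomial in the common bare
mass**: `t ↦ ∫dψ̄dψ W e^{−ψ̄ D_t ψ}` is `p(t)` for a complex polynomial `p` (expand
`e^{−t ψ̄ψ} = Σ_i (−t)^i (ψ̄ψ)^i / i!`, a finite sum since `ψ̄ψ` is nilpotent). -/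
theorem exists_polynomial_fermiIntegral_mul_fermiBoltzmann (U : GaugeConfig 4 L SU3)
    (W : FermiAlg Nf L) :
    ∃ p : Polynomial ℂ, ∀ t : ℝ,
      fermiIntegral (W * fermiBoltzmann U (fun _ : Fin Nf => t)) = p.eval (t : ℂ) := by
  obtain ⟨k, hk⟩ := isNilpotent_quadratic ℂ (1 : Matrix (FermiIdx Nf L) (FermiIdx Nf L) ℂ)
  refine ⟨∑ i ∈ Finset.range k, Polynomial.C ((i.factorial : ℂ)⁻¹ *
      fermiIntegral (W * (fermiBoltzmann U (fun _ : Fin Nf => 0) *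
        quadratic ℂ (1 : Matrix (FermiIdx Nf L) (FermiIdx Nf L) ℂ) ^ i))) *
      (-Polynomial.X) ^ i, fun t => ?_⟩
  have hexp :
      grassmannExp ((-(t : ℂ)) • quadratic ℂ (1 : Matrix (FermiIdx Nf L) (FermiIdx Nf L) ℂ)) =
        ∑ i ∈ Finset.range k, ((i.factorial : ℂ)⁻¹ * (-(t : ℂ)) ^ i) •
          quadratic ℂ (1 : Matrix (FermiIdx Nf L) (FermiIdx Nf L) ℂ) ^ i := by
    rw [grassmannExp, IsNilpotent.exp_eq_sum (k := k) (by rw [smul_pow, hk, smul_zero])]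
    refine Finset.sum_congr rfl fun i _ => ?_
    rw [smul_pow, algebra_compatible_smul ℂ ((i.factorial : ℚ)⁻¹), smul_smul, map_inv₀,
      map_natCast]
  rw [fermiBoltzmann_const_eq_mul, hexp, Finset.mul_sum, Finset.mul_sum, map_sum,
    Polynomial.eval_finsetSum]
  refine Finset.sum_congr rfl fun i _ => ?_
  rw [mul_smul_comm, mul_smul_comm, map_smul, smul_eq_mul, Polynomial.eval_mul,
    Polynomial.eval_C, Polynomial.eval_pow, Polynomial.eval_neg, Polynomial.eval_X]
  ring

/-- **The right-hand side is a polynomial in the bare mass**: with the polynomial matrix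
`M = D_W(0) + X·1` one has `det D_W(t) = (det M)(t)`, `adj D_W(t) = (adj M)(t)`, and for real `t`
`|P(t)|² = (P · P̄)(t)`. -/
theorem exists_polynomial_adjugate_side (U : GaugeConfig 4 L SU3) (x y : TorusSite 4 L) (n : ℕ)
    (ε : ℂ) :
    ∃ q : Polynomial ℂ, ∀ t : ℝ,
      ε * -((wilsonDirac (fundamentalRep (Fin 3)) U t 1).det ^ n *
        ((∑ a : Fin 3, ∑ i : Fin 4, ∑ b : Fin 3, ∑ j : Fin 4,
          ‖(wilsonDirac (fundamentalRep (Fin 3)) U t 1).adjugate (x, a, i) (y, b, j)‖ ^ (2 : ℕ) :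
            ℝ) : ℂ)) =
      q.eval (t : ℂ) := by
  set M :
      Matrix (TorusSite 4 L × Fin 3 × Fin 4) (TorusSite 4 L × Fin 3 × Fin 4) (Polynomial ℂ) :=
    (wilsonDirac (fundamentalRep (Fin 3)) U 0 1).map Polynomial.C +
      (Polynomial.X : Polynomial ℂ) • (1 : Matrix _ _ (Polynomial ℂ)) with hM
  have hMt : ∀ t : ℝ, (Polynomial.evalRingHom (t : ℂ)).mapMatrix M =
      wilsonDirac (fundamentalRep (Fin 3)) U t 1 := by
    intro t
    ext p q
    rw [wilsonDirac_mass_shift (fundamentalRep (Fin 3)) U t 1]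
    simp only [hM, RingHom.mapMatrix_apply, Matrix.map_apply, Matrix.add_apply,
      Matrix.smul_apply, Matrix.one_apply, smul_eq_mul, mul_ite, mul_one, mul_zero,
      Polynomial.coe_evalRingHom, Polynomial.eval_add, Polynomial.eval_C]
    split_ifs <;> simp
  have hdet : ∀ t : ℝ,
      (wilsonDirac (fundamentalRep (Fin 3)) U t 1).det = M.det.eval (t : ℂ) := by
    intro t
    rw [← hMt t, ← RingHom.map_det, Polynomial.coe_evalRingHom]
  have hadj : ∀ (t : ℝ) (p q : TorusSite 4 L × Fin 3 × Fin 4),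
      (wilsonDirac (fundamentalRep (Fin 3)) U t 1).adjugate p q =
        (M.adjugate p q).eval (t : ℂ) := by
    intro t p q
    rw [← hMt t, ← RingHom.map_adjugate, RingHom.mapMatrix_apply, Matrix.map_apply,
      Polynomial.coe_evalRingHom]
  have hconj : ∀ (t : ℝ) (P : Polynomial ℂ),
      (starRingEnd ℂ) (P.eval (t : ℂ)) = (P.map (starRingEnd ℂ)).eval (t : ℂ) := by
    intro t P
    rw [Polynomial.eval_map, ← Polynomial.eval₂_hom, Complex.conj_ofReal]
  refine ⟨Polynomial.C ε * -(M.det ^ n * ∑ a : Fin 3, ∑ i : Fin 4, ∑ b : Fin 3, ∑ j : Fin 4,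
      M.adjugate (x, a, i) (y, b, j) *
        (M.adjugate (x, a, i) (y, b, j)).map (starRingEnd ℂ)),
    fun t => ?_⟩
  simp only [Polynomial.eval_mul, Polynomial.eval_neg, Polynomial.eval_pow, Polynomial.eval_C,
    Polynomial.eval_finsetSum, ← hdet, ← hconj, ← hadj, Complex.mul_conj']
  push_cast
  rfl

/-- **The identity for positive bare mass** (route (A) of the module docstring): multiply the
normalised Wick contraction `pionPair_fermiRatio_eq` by the partition function
`ε det D = ε det(D_W)^{N_f}` and use `D_W⁻¹ = det(D_W)⁻¹ adj D_W` with `det D_W ∈ ℝ`. -/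
theorem pionWickNumerator_of_pos (U : GaugeConfig 4 L SU3) {t : ℝ} (ht : 0 < t) {f g : Fin Nf}
    (hfg : f ≠ g) (x y : TorusSite 4 L) :
    fermiIntegral (torusBilinear g f x x gammaFive 1 * torusBilinear f g y y gammaFive 1 *
        fermiBoltzmann U (fun _ : Fin Nf => t)) =
      (-1 : ℂ) ^ (Fintype.card (FermiIdx Nf L) * (Fintype.card (FermiIdx Nf L) - 1) / 2 +
          Fintype.card (FermiIdx Nf L)) *
        -((wilsonDirac (fundamentalRep (Fin 3)) U t 1).det ^ (Nf - 2) *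
          ((∑ a : Fin 3, ∑ i : Fin 4, ∑ b : Fin 3, ∑ j : Fin 4,
            ‖(wilsonDirac (fundamentalRep (Fin 3)) U t 1).adjugate (x, a, i) (y, b, j)‖ ^
              (2 : ℕ) : ℝ) : ℂ)) := by
  have hNf : 2 ≤ Nf := by
    by_contra h
    exact hfg (Fin.ext (by have := f.isLt; have := g.isLt; omega))
  have hdet₁ : (wilsonDirac (fundamentalRep (Fin 3)) U t 1).det ≠ 0 :=
    wilsonDirac_det_ne_zero_of_pos (fundamentalRep (Fin 3)) fundamentalRep_mem_unitaryGroup U ht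
  have hall : ∀ f' : Fin Nf,
      (wilsonDirac (fundamentalRep (Fin 3)) U ((fun _ : Fin Nf => t) f') 1).det ≠ 0 :=
    fun _ => hdet₁
  have hD : (diracMatrix U (fun _ : Fin Nf => t)).det ≠ 0 :=
    det_diracMatrix_ne_zero_of_pos U _ fun _ => ht
  have hZ := fermiIntegral_fermiBoltzmann U (fun _ : Fin Nf => t)
  have hZne : fermiIntegral (fermiBoltzmann U (fun _ : Fin Nf => t)) ≠ 0 := by
    rw [hZ]
    exact mul_ne_zero (fermiOrientationSign_ne_zero _) hD
  have hratio :=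
    PhaseQuenchedFlavourDecay.CrossingSplitIntegrability.pionPair_fermiRatio_eq
      U (fun _ : Fin Nf => t) hfg rfl x y
  rw [div_eq_iff hZne] at hratio
  have hdetD : (diracMatrix U (fun _ : Fin Nf => t)).det =
      (wilsonDirac (fundamentalRep (Fin 3)) U t 1).det ^ Nf := by
    rw [det_diracMatrix]
    simp only [Finset.prod_const, Finset.card_univ, Fintype.card_fin]
  have hG : ∀ p q : TorusSite 4 L × Fin 3 × Fin 4,
      (diracMatrix U (fun _ : Fin Nf => t))⁻¹ (quarkEquiv (f, p)) (quarkEquiv (f, q)) =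
        ((wilsonDirac (fundamentalRep (Fin 3)) U t 1).det)⁻¹ *
          (wilsonDirac (fundamentalRep (Fin 3)) U t 1).adjugate p q := by
    intro p q
    rw [inv_diracMatrix_apply_same_flavour U _ hall f p q, Matrix.inv_def, Ring.inverse_eq_inv,
      Matrix.smul_apply, smul_eq_mul]
  have hreal : (starRingEnd ℂ) (wilsonDirac (fundamentalRep (Fin 3)) U t 1).det =
      (wilsonDirac (fundamentalRep (Fin 3)) U t 1).det :=
    Complex.conj_eq_iff_im.2 (fermionDet_wilsonDirac_im_holds (L := L) (fundamentalRep (Fin 3))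
      (fun g => fundamentalRep_mem_unitaryGroup g) U t 1)
  have hnorm : ((‖(wilsonDirac (fundamentalRep (Fin 3)) U t 1).det‖ : ℝ) : ℂ) ^ 2 =
      (wilsonDirac (fundamentalRep (Fin 3)) U t 1).det ^ 2 := by
    rw [← Complex.mul_conj', hreal, pow_two]
  rw [hratio, hZ, hdetD]
  simp only [hG, norm_mul, norm_inv, mul_pow, ← Finset.mul_sum, inv_pow]
  push_cast
  rw [hnorm, ← Nat.sub_add_cancel hNf, pow_add, Nat.add_sub_cancel]
  field_simp
  ring

/-- **Un-normalised Wick contraction of the charged pion pair in every gauge background** (all real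
bare masses `t`, including singular `D_W(U,t)`):
`∫dψ̄dψ (ψ̄_g γ₅ ψ_f)(x) (ψ̄_f γ₅ ψ_g)(y) e^{−ψ̄ D_t ψ}
  = ε · (−det(D_W(t))^{N_f−2} Σ_{a,i,b,j} |adj D_W(t)((x,a,i),(y,b,j))|²)`, `ε = (−1)^{n(n−1)/2+n}`.
For `t > 0` this is `pionWickNumerator_of_pos`; both sides are complex
polynomials in `t` (`exists_polynomial_fermiIntegral_mul_fermiBoltzmann`,
`exists_polynomial_adjugate_side`) agreeing on the infinite set `t > 0`, hence everywhere
(Montvay–Münster 1994 §4.1 (4.17), (4.25); §5.1.2 (5.15)–(5.16)). -/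
theorem stub_pionWickNumerator :
    ∀ (Nf L : ℕ) [NeZero L] (U : GaugeConfig 4 L (Matrix.specialUnitaryGroup (Fin 3) ℂ)) (t : ℝ) (f g : Fin Nf),
      f ≠ g → ∀ (x y : TorusSite 4 L), fermiIntegral (torusBilinear g f x x gammaFive 1 * torusBilinear f g y y gammaFive 1 * fermiBoltzmann U (fun _ : Fin Nf => t)) = (-1 : ℂ) ^ (Fintype.card (FermiIdx Nf L) * (Fintype.card (FermiIdx Nf L) - 1) / 2 + Fintype.card (FermiIdx Nf L)) * -((wilsonDirac (fundamentalRep (Fin 3)) U t 1).det ^ (Nf - 2) * ((∑ a : Fin 3, ∑ i : Fin 4, ∑ b : Fin 3, ∑ j : Fin 4, ‖(wilsonDirac (fundamentalRep (Fin 3)) U t 1).adjugate (x, a, i) (y, b, j)‖ ^ (2 : ℕ) : ℝ) : ℂ)) := by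
  intro Nf L _ U t f g hfg x y
  obtain ⟨p, hp⟩ := exists_polynomial_fermiIntegral_mul_fermiBoltzmann U
    (torusBilinear g f x x gammaFive 1 * torusBilinear f g y y gammaFive 1)
  obtain ⟨q, hq⟩ := exists_polynomial_adjugate_side U x y (Nf - 2)
    ((-1 : ℂ) ^ (Fintype.card (FermiIdx Nf L) * (Fintype.card (FermiIdx Nf L) - 1) / 2 +
      Fintype.card (FermiIdx Nf L)))
  have hpq : p = q := by
    apply Polynomial.eq_of_infinite_eval_eq
    refine Set.infinite_of_injOn_mapsTo Complex.ofReal_injective.injOn ?_ (Set.Ioi_infinite (0 : ℝ))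
    intro s hs
    show p.eval (s : ℂ) = q.eval (s : ℂ)
    rw [← hp, ← hq]
    exact pionWickNumerator_of_pos U hs hfg x y
  rw [hp, hq, hpq]

end Summit.QuantumFields.QCD.Cruxes.ChiralOneScaleTrajectory.GoldstoneWitness

end
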